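import Mathlib
import HarnessLib
import Literature.Analysis.FluidPDE.ClassicalSolution
import Literature.Analysis.FluidPDE.ClassicalSolutionRescale
import Literature.Analysis.FluidPDE.ClassicalSolutionGlue
import Literature.Analysis.FluidPDE.SelfSimilar
import Literature.Analysis.FluidPDE.AxisymmetricEuler
import Literature.Analysis.FluidPDE.NSLerayStrongLocalExistence
import Literature.Analysis.FluidPDE.NSBoundedMildSmoothing
import Literature.Analysis.FluidPDE.KNSSOseenMildDecayOfLemma31
import Literature.Analysis.FluidPDE.KNSSWeakDriftMildProofs
import Literature.Analysis.FluidPDE.ChaeWolfRemovingDSSBounds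
import Literature.Analysis.FluidPDE.ChaeWolfRemovingDSSLimit
import Literature.Analysis.FluidPDE.KNSSBlowupLimit
import Summits.NavierStokesRegularity.NavierStokesRegularity.Theorems.TypeICertificateLadderTargetRssCompactnessPressureCover
import Summits.NavierStokesRegularity.NavierStokesRegularity.Theorems.LocalSineTubeDoorProfileAlignedWindowRigidityAncient
import Summits.NavierStokesRegularity.NavierStokesRegularity.Theorems.ZoomReturnDoorDefs
import Summits.NavierStokesRegularity.NavierStokesRegularity.Theorems.ZoomReturnDoorDssExtension
import Summits.NavierStokesRegularity.NavierStokesRegularity.Theorems.ZoomReturnDoorLimit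

/-!
# ZoomReturnDoorExtraction — S25 «ZoomReturnDoor», kit part 7/7 §1: E1 extraction and E3 analytic slices (PROVED)

E1 `extraction`: Chae–Wolf compactness re-run WITHOUT discrete self-similarity (`ChaeWolf.exists_uniform_lipschitz` — uniform
space/time Lipschitz bounds on `t ≤ −1/4` over all classical Type-I(`D`) fields — + `exists_strictMono_tendsto_of_lipschitzWith`
on the fields frozen at `−1/4`; locally uniform upgrade; decay, bounded-weak form and the witness pass to the limit).
E3 `analytic_slices_of_decay` (the kit's `stub_analytic_slices`, proved there already): slices of a bounded, decaying,
classical ancient field are real-analytic (`oseenMild_of_cylRadius_decay_window KNSS2009_weak_driftMild_holds` + time shift +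
`analyticOnNhd_slice`).

Door family of LADDER-NS N0; THEOREMS-ONLY landing (lane ns-door-S23-p1, DIRECTOR-NS #73 (2)) of the nsreg-p1 g20 kit part 7/7
`run/shared/lean/pub/ns-regularity-ideate/ns-regularity-ideate-p1/r24/landing/ZoomReturnDoorSkeleton.lean` (ADDENDUM-24C rev 3,
93b5c61024a69aa0), split into three files ≤ 400 lines; its one stub E2 `stub_classical_limit` is the tree theorem
`ZoomReturnDoorClassicalLimit.classical_limit`. WHAT THIS IS NOT: not NS regularity; no route, no item.
-/

noncomputable section

set_option linter.dupNamespace false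

namespace Summit.NavierStokesRegularity.NavierStokesRegularity.Theorems.ZoomReturnDoorExtraction

open MeasureTheory Set Function Filter Topology Metric
open scoped ENNReal NNReal Topology
open Literature.Analysis Literature.Analysis.FluidPDE
open Summit.NavierStokesRegularity.NavierStokesRegularity.Theorems.ZoomReturnDoorDefs
open Summit.NavierStokesRegularity.NavierStokesRegularity.Theorems.ZoomReturnDoorDssExtension
open Summit.NavierStokesRegularity.NavierStokesRegularity.Theorems.ZoomReturnDoorLimit

/-! ## §1 E1 extraction (proved), the ONE STUB E2 (the only `sorry` of the skeleton), E3 analytic slices (proved) -/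

/-- **E1 — EXTRACTION** (PROVED re-run of the tree's Chae–Wolf compactness `ChaeWolf.exists_limit` WITHOUT its DSS
hypotheses: `ChaeWolf.exists_uniform_lipschitz` — uniform space/time Lipschitz bounds on `t ≤ −1/4` over ALL classical
Type-I(`D`) fields — + `exists_strictMono_tendsto_of_lipschitzWith` on the fields frozen at `−1/4`; the equi-Lipschitz
modulus upgrades pointwise to LOCALLY UNIFORM convergence (ε–δ–N form, survives further subsequences); the decay and the
bounded-weak form pass to the limit (`isBoundedWeakNSSolutionOn_of_tendsto`); the witness by compactness of
`closedBall 0 R` and `ChaeWolf.tendsto_apply_of_tendsto`). -/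
theorem extraction {D R η T : ℝ} (hD : 0 < D) (hT : T ≤ -1) {u : ℕ → ℝ → EuclideanSpace ℝ (Fin 3) → EuclideanSpace ℝ (Fin 3)} {p : ℕ → ℝ → EuclideanSpace ℝ (Fin 3) → ℝ}
    (hcl : ∀ n, IsClassicalNSSolutionOn (Iio 0) 1 0 (u n) (p n)) (hdec : ∀ n, HasTypeIDecay D (u n))
    {x : ℕ → EuclideanSpace ℝ (Fin 3)} (hx : ∀ n, ‖x n‖ ≤ R) (hη : ∀ n, η ≤ ‖u n T (x n)‖) :
    ∃ (φ : ℕ → ℕ) (v : ℝ → EuclideanSpace ℝ (Fin 3) → EuclideanSpace ℝ (Fin 3)), StrictMono φ ∧ Continuous (uncurry v) ∧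
      IsBoundedWeakNSSolutionOn (Iio 0) isOpen_Iio 1 (fun t => v (t - 1 / 4)) ∧
      (∀ t < -(1 / 4 : ℝ), ∀ (y : EuclideanSpace ℝ (Fin 3)) (ε : ℝ), 0 < ε → ∃ δ > 0, ∃ N : ℕ, ∀ n ≥ N, ∀ (t' : ℝ) (y' : EuclideanSpace ℝ (Fin 3)),
        |t' - t| < δ → dist y' y < δ → dist (u (φ n) t' y') (v t y) < ε) ∧
      (∀ t ≤ -(1 / 4 : ℝ), ∀ y, ‖v t y‖ ≤ D / (‖y‖ + Real.sqrt (-t))) ∧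
      ∃ xbar : EuclideanSpace ℝ (Fin 3), η ≤ ‖v T xbar‖ := by
  obtain ⟨K, L, hK, hL, hKL⟩ := ChaeWolf.exists_uniform_lipschitz hD.le
  -- the equi-Lipschitz family on `ℝ × ℝ³` (fields frozen at time `-1/4` for later times), as in `ChaeWolf.exists_limit`
  set Kx : ℝ≥0 := (K + L).toNNReal with hKx
  have hKx' : (Kx : ℝ) = K + L := by rw [hKx, Real.coe_toNNReal _ (by positivity)]
  set f : ℕ → ℝ × EuclideanSpace ℝ (Fin 3) → EuclideanSpace ℝ (Fin 3) := fun n q => u n (min q.1 (-(1 / 4 : ℝ))) q.2 with hf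
  have hf_of_le : ∀ n {t : ℝ} (_ : t ≤ -(1 / 4 : ℝ)) (x : EuclideanSpace ℝ (Fin 3)), f n (t, x) = u n t x :=
    fun n t ht x => by simp only [hf, min_eq_left ht]
  have hlip : ∀ n, LipschitzWith Kx (f n) := by
    intro n
    obtain ⟨hsp, htm⟩ := hKL (hcl n) (hdec n)
    refine LipschitzWith.of_dist_le_mul fun q q' => ?_
    rw [hKx', dist_eq_norm, Prod.dist_eq, Real.dist_eq, dist_eq_norm]
    have hm : min q.1 (-(1 / 4 : ℝ)) ≤ -(1 / 4 : ℝ) := min_le_right _ _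
    have hm' : min q'.1 (-(1 / 4 : ℝ)) ≤ -(1 / 4 : ℝ) := min_le_right _ _
    have hmin : |min q.1 (-(1 / 4 : ℝ)) - min q'.1 (-(1 / 4 : ℝ))| ≤ |q.1 - q'.1| := by
      refine (abs_min_sub_min_le_max _ _ _ _).trans (max_le le_rfl ?_)
      rw [sub_self, abs_zero]; exact abs_nonneg _
    calc ‖u n (min q.1 (-(1 / 4))) q.2 - u n (min q'.1 (-(1 / 4))) q'.2‖
        ≤ ‖u n (min q.1 (-(1 / 4))) q.2 - u n (min q.1 (-(1 / 4))) q'.2‖ +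
            ‖u n (min q.1 (-(1 / 4))) q'.2 - u n (min q'.1 (-(1 / 4))) q'.2‖ :=
          norm_sub_le_norm_sub_add_norm_sub _ _ _
      _ ≤ K * ‖q.2 - q'.2‖ + L * |min q.1 (-(1 / 4 : ℝ)) - min q'.1 (-(1 / 4 : ℝ))| :=
          add_le_add (hsp _ hm _ _) (htm _ hm' _ hm _)
      _ ≤ K * max |q.1 - q'.1| ‖q.2 - q'.2‖ + L * max |q.1 - q'.1| ‖q.2 - q'.2‖ := by
          gcongr
          · exact le_max_right _ _
          · exact hmin.trans (le_max_left _ _)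
      _ = (K + L) * max |q.1 - q'.1| ‖q.2 - q'.2‖ := by ring
  have hball : ∀ n q, f n q ∈ closedBall (0 : EuclideanSpace ℝ (Fin 3)) (2 * D) := fun n q => by
    rw [mem_closedBall, dist_zero_right]
    exact ChaeWolf.typeI_norm_le_two_mul hD.le (hdec n) (min_le_right _ _) _
  obtain ⟨φ, l, hφ, hl, -, hlim⟩ := exists_strictMono_tendsto_of_lipschitzWith f hlip hball
  -- the limit field
  set v : ℝ → EuclideanSpace ℝ (Fin 3) → EuclideanSpace ℝ (Fin 3) := fun t x => l (t, x) with hv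
  have hlimv : ∀ {t : ℝ} (_ : t ≤ -(1 / 4 : ℝ)) (x : EuclideanSpace ℝ (Fin 3)), Tendsto (fun n => u (φ n) t x) atTop (𝓝 (v t x)) := by
    intro t ht x
    simpa only [hf_of_le _ ht] using hlim (t, x)
  have hvc : Continuous (uncurry v) := by
    have e : uncurry v = l := by funext q; rfl
    rw [e]; exact hl.continuous
  refine ⟨φ, v, hφ, hvc, ?_, ?_, ?_, ?_⟩
  · -- bounded weak solution on `(-∞, -1/4)`, shifted to `(-∞, 0)` (verbatim from `ChaeWolf.exists_limit`)
    have hA' : Tendsto (fun k : ℕ => -(k : ℝ) + -1) atTop atBot :=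
      (tendsto_neg_atTop_atBot.comp tendsto_natCast_atTop_atTop).atBot_add tendsto_const_nhds
    have e14 : ∀ t : ℝ, t - 1 / 4 = t + -(1 / 4 : ℝ) := fun t => by ring
    have hV : ∀ k : ℕ, IsBoundedWeakNSSolutionOn (Ioo (-(k : ℝ) + -1) 0) isOpen_Ioo 1
        (fun t => u (φ k) (t - 1 / 4)) := by
      intro k
      have hcl' : IsClassicalNSSolutionOn (Ioo (-(k : ℝ) + -1 + -(1 / 4)) (-(1 / 4))) 1 0
          (u (φ k)) (p (φ k)) :=
        (hcl (φ k)).mono (fun t ht => by simp only [mem_Iio]; linarith [ht.2]) (uniqueDiffOn_Ioo _ _)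
      have hbdd : IsBoundedOn (Ioo (-(k : ℝ) + -1 + -(1 / 4)) (-(1 / 4))) (u (φ k)) :=
        ⟨2 * D, fun t ht x => ChaeWolf.typeI_norm_le_two_mul hD.le (hdec (φ k)) ht.2.le x⟩
      have h := (hcl'.isBoundedWeakNSSolutionOn hbdd).comp_add_right (-(1 / 4 : ℝ))
        (J := Ioo (-(k : ℝ) + -1) 0) isOpen_Ioo fun t => by
          simp only [mem_Ioo]
          constructor <;> intro h <;> constructor <;> linarith [h.1, h.2]
      simpa only [e14] using h
    have hcont : ∀ k : ℕ, ContinuousOn (uncurry fun t => u (φ k) (t - 1 / 4))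
        (Ioo (-(k : ℝ) + -1) 0 ×ˢ univ) := by
      intro k
      have h1 := ((hcl (φ k)).smooth_velocity.comp_add_right (-(1 / 4 : ℝ))).continuousOn
      refine (h1.mono (prod_mono (fun t ht => ?_) Subset.rfl)).congr fun q _ => by
        simp only [uncurry, e14]
      simp only [mem_preimage, mem_Iio]
      linarith [ht.2]
    have hbd : ∀ k : ℕ, ∀ t ∈ Ioo (-(k : ℝ) + -1) 0, ∀ x, ‖u (φ k) (t - 1 / 4) x‖ ≤ 2 * D :=
      fun k t ht x => ChaeWolf.typeI_norm_le_two_mul hD.le (hdec (φ k)) (by linarith [ht.2]) x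
    have hvc' : Continuous (uncurry fun t x => v (t - 1 / 4) x) :=
      hvc.comp ((continuous_fst.sub continuous_const).prodMk continuous_snd)
    exact isBoundedWeakNSSolutionOn_of_tendsto hA' hV hcont hbd hvc' fun t ht x => hlimv (by linarith) x
  · -- locally uniform convergence below `-1/4` from the equi-Lipschitz modulus
    intro t ht y ε hε
    obtain ⟨N, hN⟩ := (Metric.tendsto_atTop.1 (hlimv ht.le y)) (ε / 2) (by positivity)
    refine ⟨min (ε / (2 * (K + L + 1))) ((-(1 / 4 : ℝ) - t) / 2), lt_min (by positivity) (by linarith), N,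
      fun n hn t' y' ht' hy' => ?_⟩
    have hδ1 : |t' - t| < ε / (2 * (K + L + 1)) := ht'.trans_le (min_le_left _ _)
    have hδ2 : |t' - t| < (-(1 / 4 : ℝ) - t) / 2 := ht'.trans_le (min_le_right _ _)
    have hy1 : dist y' y < ε / (2 * (K + L + 1)) := hy'.trans_le (min_le_left _ _)
    have ht'le : t' ≤ -(1 / 4 : ℝ) := by
      have := (abs_lt.1 hδ2).2
      linarith
    have h1 : dist (u (φ n) t' y') (u (φ n) t y) ≤ (K + L) * max |t' - t| (dist y' y) := by
      have := (hlip (φ n)).dist_le_mul (t', y') (t, y)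
      rw [hf_of_le _ ht'le, hf_of_le _ ht.le, hKx', Prod.dist_eq, Real.dist_eq] at this
      exact this
    have hmax : max |t' - t| (dist y' y) < ε / (2 * (K + L + 1)) := max_lt hδ1 hy1
    have h2 : (K + L) * max |t' - t| (dist y' y) < ε / 2 := by
      have hKL0 : 0 ≤ K + L := by positivity
      calc (K + L) * max |t' - t| (dist y' y) ≤ (K + L) * (ε / (2 * (K + L + 1))) := by gcongr
        _ < ε / 2 := by
          rw [show (K + L) * (ε / (2 * (K + L + 1))) = ε / 2 * ((K + L) / (K + L + 1)) by field_simp]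
          have : (K + L) / (K + L + 1) < 1 := by rw [div_lt_one (by positivity)]; linarith
          nlinarith
    calc dist (u (φ n) t' y') (v t y) ≤ dist (u (φ n) t' y') (u (φ n) t y) + dist (u (φ n) t y) (v t y) :=
          dist_triangle _ _ _
      _ < ε / 2 + ε / 2 := add_lt_add (h1.trans_lt h2) (hN n hn)
      _ = ε := by ring
  · -- the Type I bound passes to the limit
    intro t ht y
    exact le_of_tendsto' (hlimv ht y).norm fun n => hdec (φ n) t (by linarith) y
  · -- the witness survives (compactness of `closedBall 0 R` + equi-Lipschitz continuous convergence)
    obtain ⟨xbar, -, ψ, hψ, hxlim⟩ := (isCompact_closedBall (0 : EuclideanSpace ℝ (Fin 3)) R).tendsto_subseq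
      (x := x ∘ φ) fun n => mem_closedBall_zero_iff.2 (hx (φ n))
    refine ⟨xbar, ?_⟩
    have hT4 : T ≤ -(1 / 4 : ℝ) := by linarith
    have hq : Tendsto (fun n => ((T, x (φ (ψ n))) : ℝ × EuclideanSpace ℝ (Fin 3))) atTop (𝓝 (T, xbar)) :=
      tendsto_const_nhds.prodMk_nhds hxlim
    have h1 : Tendsto (fun n => f (φ (ψ n)) (T, x (φ (ψ n)))) atTop (𝓝 (v T xbar)) :=
      ChaeWolf.tendsto_apply_of_tendsto (fun n => hlip (φ (ψ n))) hq ((hlim (T, xbar)).comp hψ.tendsto_atTop)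
    have h2 : Tendsto (fun n => ‖u (φ (ψ n)) T (x (φ (ψ n)))‖) atTop (𝓝 ‖v T xbar‖) := by
      refine (h1.congr fun n => ?_).norm
      exact hf_of_le _ hT4 _
    exact ge_of_tendsto' h2 fun n => hη (φ (ψ n))

/-- **E3 — ANALYTIC SLICES of a bounded, decaying, classical ancient field** (PROVED from the tree: Oseen-mild on every window by
`oseenMild_of_cylRadius_decay_window KNSS2009_weak_driftMild_holds` (`cylRadius x ≤ ‖x‖`), then
`analyticOnNhd_slice` / `IsTypeIAncientMild.analyticOnNhd_slice_univ` after a time shift of the window to `Iio 0`). -/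
theorem analytic_slices_of_decay {t₁ L D' : ℝ} {v : ℝ → EuclideanSpace ℝ (Fin 3) → EuclideanSpace ℝ (Fin 3)} {q : ℝ → EuclideanSpace ℝ (Fin 3) → ℝ}
    (hv : IsClassicalNSSolutionOn (Iio t₁) 1 0 v q) (hL : ∀ t < t₁, ∀ x, ‖v t x‖ ≤ L)
    (hD' : ∀ t < t₁, ∀ x : EuclideanSpace ℝ (Fin 3), ‖x‖ * ‖v t x‖ ≤ D') : ∀ t < t₁, AnalyticOnNhd ℝ (v t) univ := by
  -- distance to the axis ≤ distance to the origin
  have hcyl : ∀ x : EuclideanSpace ℝ (Fin 3), cylRadius x ≤ ‖x‖ := by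
    intro x
    rw [cylRadius, EuclideanSpace.norm_eq]
    apply Real.sqrt_le_sqrt
    have h : ∑ i : Fin 3, ‖x i‖ ^ 2 = x 0 ^ 2 + x 1 ^ 2 + x 2 ^ 2 := by
      simp [Fin.sum_univ_three, Real.norm_eq_abs, sq_abs]
    rw [h]
    nlinarith [sq_nonneg (x 2)]
  -- the shifted ancient field `V τ := v (τ + t₁)` on `Iio 0`
  set V : ℝ → EuclideanSpace ℝ (Fin 3) → EuclideanSpace ℝ (Fin 3) := fun τ => v (τ + t₁) with hV_def
  have hVcl : IsClassicalNSSolutionOn (Iio 0) 1 0 V (fun τ => q (τ + t₁)) := by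
    have h1 := hv.comp_add_right t₁
    have hS : (fun τ : ℝ => τ + t₁) ⁻¹' Iio t₁ = Iio 0 := by
      ext τ; simp
    rw [hS] at h1
    exact h1
  have hcont : ContinuousOn (uncurry V) (Iio (0 : ℝ) ×ˢ univ) := hVcl.smooth_velocity.continuousOn
  have hbdd : ∀ δ : ℝ, 0 < δ → ∃ B : ℝ, ∀ t < -δ, ∀ y : EuclideanSpace ℝ (Fin 3), ‖V t y‖ ≤ B :=
    fun δ hδ => ⟨L, fun t ht y => hL (t + t₁) (by linarith) y⟩
  -- Oseen-mildness on every pair `s < t < 0` via KNSS on the window shifted to `(0, 1 - s)`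
  have hmild : ∀ s t : ℝ, s < t → t < 0 → ∀ y : EuclideanSpace ℝ (Fin 3),
      V t y = UnboundedOperators.heatExtension (V s) (t - s) y - oseenDuhamel 1 s V V t y := by
    intro s t hst ht0 y
    set a : ℝ := s - 1 with ha_def
    set W : ℝ → EuclideanSpace ℝ (Fin 3) → EuclideanSpace ℝ (Fin 3) := fun σ => V (σ + a) with hW_def
    have hWcl : IsClassicalNSSolutionOn (Ioo 0 (-a)) 1 0 W (fun σ => q (σ + a + t₁)) := by
      have h1 := hVcl.comp_add_right a
      refine (h1.mono (fun σ hσ => ?_) (uniqueDiffOn_Ioo 0 (-a))).congr_velocity fun σ _ => rfl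
      simp only [mem_preimage, mem_Iio]
      linarith [hσ.2]
    have hWL : ∀ σ ∈ Ioo 0 (-a), ∀ x, ‖W σ x‖ ≤ L := fun σ hσ x => hL (σ + a + t₁) (by linarith [hσ.2]) x
    have hWD : ∀ σ ∈ Ioo 0 (-a), ∀ x : EuclideanSpace ℝ (Fin 3), cylRadius (x - 0) * ‖W σ x‖ ≤ D' := by
      intro σ hσ x
      rw [sub_zero]
      exact (mul_le_mul_of_nonneg_right (hcyl x) (norm_nonneg _)).trans (hD' (σ + a + t₁) (by linarith [hσ.2]) x)
    have hm := oseenMild_of_cylRadius_decay_window KNSS2009_weak_driftMild_holds hWcl hWL hWD (s - a) (t - a)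
      (by rw [ha_def]; linarith) (by linarith) (by linarith) y
    -- translate back
    have e1 : W (t - a) = V t := by simp [hW_def]
    have e2 : W (s - a) = V s := by simp [hW_def]
    have e3 : oseenDuhamel 1 (s - a) W W (t - a) y = oseenDuhamel 1 s V V t y := by
      have := oseenDuhamel_translate 1 (s - a) a V V (t - a) y
      rw [sub_add_cancel, sub_add_cancel] at this
      exact this
    rw [e1, e2, e3, show t - a - (s - a) = t - s by ring] at hm
    exact hm
  intro t ht
  have han := LocalSineTubeDoorProfileAlignedWindowRigidityAncient.analyticOnNhd_slice hcont hbdd hmild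
    (t := t - t₁) (by linarith)
  have e : V (t - t₁) = v t := by simp [hV_def]
  rwa [e] at han

end Summit.NavierStokesRegularity.NavierStokesRegularity.Theorems.ZoomReturnDoorExtraction

end
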